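import Summits.Schanuel.Schanuel.Theses.DiophantineDichotomy
import Summits.Schanuel.Schanuel.Theorems.DiophantineDichotomyApproximationRace
import Summits.Schanuel.Schanuel.Theorems.DiophantineDichotomyKhovanskiiReduction

/-!
# Route `DiophantineDichotomy`, assembly: the two cruxes decide Schanuel's conjecture

`Summit.Schanuel.Schanuel.Theses.DiophantineDichotomy.Assembly` (item stmt-Schanuel-14920, the
2026-08-16 restatement of stmt-Schanuel-6124) is the implication

`ApproximationProperty → KhovanskiiApproxType → Schanuel`,

i.e. the route's deciding theorem `Summit.Schanuel.Schanuel.Theses.DiophantineDichotomy.closes`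
with its two glue hypotheses discharged by their landed proofs:

* `Summit.Schanuel.Schanuel.Theorems.approximationRace_proof : ApproximationRace`, where
  `ApproximationRace := ApproximationProperty → KhovanskiiApproxType → KhovanskiiSchanuel`
  (the exponent race at free Khovanskii points, item stmt-Schanuel-6119, module
  `Summits.Schanuel.Schanuel.Theorems.DiophantineDichotomyApproximationRace`), and
* `Summit.Schanuel.Schanuel.Theorems.khovanskiiReduction_proof : KhovanskiiReduction`, where
  `KhovanskiiReduction := KhovanskiiSchanuel → Schanuel` (the δ-minimal-counterexample reduction via
  Ax's rank inequality and the Khovanskii dichotomy, item stmt-Schanuel-6120, module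
  `Summits.Schanuel.Schanuel.Theorems.DiophantineDichotomyKhovanskiiReduction`).

So the assembly is: feed the two cruxes to the race to obtain the route target
`KhovanskiiSchanuel`, then apply the reduction — the term
`khovanskiiReduction_proof (approximationRace_proof hAP hAT)`.

## Contents

* `diophantineDichotomy_assembly_proof : Assembly` — the route decl, verbatim.

Neither crux (`ApproximationProperty`, `KhovanskiiApproxType`) is discharged here; they remain the
hypotheses of the implication.
-/

-- `Summit.<Summit>.<Problem>` is the mandated summit-side namespace (CONVENTIONS §2); for the
-- single-conjunct summit `Schanuel` the two coincide, so the duplicate `Schanuel.Schanuel` is deliberate.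
set_option linter.dupNamespace false

namespace Summit.Schanuel.Schanuel.Theorems

/-- **Assembly of route `DiophantineDichotomy`** (route decl
`Summit.Schanuel.Schanuel.Theses.DiophantineDichotomy.Assembly`, item stmt-Schanuel-14920):
`ApproximationProperty → KhovanskiiApproxType → Schanuel`.
The exponent race `approximationRace_proof : ApproximationProperty → KhovanskiiApproxType →
KhovanskiiSchanuel` turns the two cruxes into Schanuel's conjecture at free Khovanskii points, and
the reduction `khovanskiiReduction_proof : KhovanskiiSchanuel → Schanuel` (δ-minimal counterexample,
Ax's rank inequality, Khovanskii dichotomy) turns that into the summit statement; the proof term is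
`khovanskiiReduction_proof (approximationRace_proof hAP hAT)`, the deciding theorem `closes` with its
two support hypotheses supplied. [folklore] -/
theorem diophantineDichotomy_assembly_proof :
    Summit.Schanuel.Schanuel.Theses.DiophantineDichotomy.Assembly := by
  unfold Summit.Schanuel.Schanuel.Theses.DiophantineDichotomy.Assembly
  intro hAP hAT
  exact khovanskiiReduction_proof (approximationRace_proof hAP hAT)

end Summit.Schanuel.Schanuel.Theorems
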